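import Summits.CriticalPhenomena.PercolationContinuityZ3.Theses.PercNearOneGluing
import Summits.CriticalPhenomena.PercolationContinuityZ3.Theorems.PercNearOneGluingNearOneGluingTerminalSeparation
import Summits.CriticalPhenomena.PercolationContinuityZ3.Theorems.PercNearOneGluingNearOneGluingSingleFinger
import Summits.CriticalPhenomena.PercolationContinuityZ3.Theorems.PercNearOneGluingNearOneGluingDyadicThinning
import Summits.CriticalPhenomena.PercolationContinuityZ3.Theorems.PercNearOneGluingNearOneGluingWeightContinuity
import Summits.CriticalPhenomena.PercolationContinuityZ3.Theorems.PercNearOneGluingNoHeavyLowerTailSpreadSwitch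
import Summits.CriticalPhenomena.PercolationContinuityZ3.Theorems.PercNearOneGluingNoHeavyLowerTailOneFingerHub
import Summits.CriticalPhenomena.PercolationContinuityZ3.Theorems.PercNearOneGluingNoHeavyLowerTailFewFingersHub
import Literature.Probability.Percolation.ConditionalPositiveAssociation
import Literature.Probability.Percolation.ConditionalPositiveAssociationProofs
import Literature.Probability.Percolation.PercolationProofs

/-!
# The REDUCTION of `PercNearOneGluing.NoHeavyLowerTail` to the many-finger large-pocket residual

Contents (the residual statement enters as a hypothesis):

* `nhlt_singleFingerHub` — Kozma–Nitzan arXiv:2401.12397 Lemma 2 with SINGLETON blocks, hub form: if every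
  `a ∈ T` has `P(a ↮ a₀) ≤ t` then `P(|C(o) ∩ T| = 1, o ↮ a₀) ≤ t` with NO factor `|T|` (BHK 2006 Thm 1.3
  ⇒ terminal separation ⇒ single finger).
* `nhlt_logScaleLowerTail` — the log-scale lower tail (constant 16): for a hub `a₀ ∈ A`
  with star budget `δ₀` and ANY observer `o`, `P(o ↮ a₀, 1 ≤ |C(o) ∩ (A∖a₀)| < t) ≤ 16 δ₀ ⌈log₂ t⌉`
  (dyadic Bernoulli thinning of the relay set, `stub_dyadicThinning`).
* `nhlt_hubBlockMarkov` — on `{o ↔ a₀}` the bad event is a large deviation of the hub's block: Markov.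
* `noHeavyLowerTail_of_manyFingersLargePocket` — **the reduction**: the residual statement
  (∀ ε ∃ δ d₀ s₀: pairwise `δ`-reliable `A`, hub `a₀ ∈ A`, observer `o ∉ A` with `P(o ↮ A) ≤ δ` ⇒
  `P(o ↮ a₀, s₀ ≤ N', 2N' ≤ |A|, |D| > d₀) ≤ ε`, `N' = |C(o) ∩ (A∖a₀)|`, `D` = pioneers of `o` = relay points
  reached by an open path avoiding `A` elsewhere) IMPLIES `NoHeavyLowerTail`, using
  `stub_spreadSwitch`, `stub_oneFingerHub` and `stub_fewFingersHub`.
  The residual is implied by `NoHeavyLowerTail` (its event lies in `{o ↔ A} ∩ {o ↮ a₀}`, and `NoHeavyLowerTail`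
  is equivalent to KN Conjecture 3: `NoHeavyLowerTail ⇒ NearOneGluing` is `noHeavyLowerTailSuffices_proof`,
  `NearOneGluing ⇒ residual` is `manyFingersLargePocket_of_nearOneGluing` (`…ResidualOfNearOneGluing.lean`),
  `NearOneGluing ⇔` Conjecture 3 is `nearOneGluing_iff_conjecture3`), so it is an EQUIVALENT form of
  `NoHeavyLowerTail` isolating the
  configurations that neither the BHK lever (the log-scale lower tail) nor the finger count (spread switch)
  reaches: large (≥ s₀), sparse (≤ |A|/2) pockets cut from the hub and entered through more than d₀
  conditionally independent pioneers, for every fixed d₀, s₀.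
-/

noncomputable section

namespace Summit.CriticalPhenomena.PercolationContinuityZ3.Theorems

open scoped Classical BigOperators Topology
open MeasureTheory Set Filter
open Literature.Probability.LatticeModels (prodBernoulli)
open Literature.Probability.Percolation (openConn openConnIn BondConfig
  BHK2006_clusterConditionalPositiveAssociation BHK2006_clusterConditionalPositiveAssociation_holds
  measurableSet_openConn_holds)
open Summit.CriticalPhenomena.PercolationContinuityZ3.Theses.PercNearOneGluing (NoHeavyLowerTail)

/-- **Single-finger lemma, hub form** (Kozma–Nitzan arXiv:2401.12397 Lemma 2 with singleton blocks on the
ground set `T ∪ {a₀}`; van den Berg–Häggström–Kahn 2006 Thm 1.3): if every `a ∈ T` has `P(a ↮ a₀) ≤ t`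
then `P(exactly one point of T is joined to o, and o ↮ a₀) ≤ t`, with NO factor `|T|`.
Chain: BHK Thm 1.3 (`BHK2006_clusterConditionalPositiveAssociation_holds`, at `Fin n`) ⇒ terminal
separation ⇒ single finger (weight continuity disposes of null separation events). -/
theorem nhlt_singleFingerHub :
    ∀ (n : ℕ) (w : Sym2 (Fin n) → unitInterval) (T : Finset (Fin n)) (o a₀ : Fin n) (t : ℝ),
      0 ≤ t → (∀ a ∈ T, (prodBernoulli w).real (openConn a a₀)ᶜ ≤ t) →
      (prodBernoulli w).real {ω : BondConfig (Fin n) |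
          (T.filter fun a => ω ∈ openConn o a).card = 1 ∧ ω ∉ openConn o a₀} ≤ t := by
  refine stub_singleFinger (stub_terminalSeparation ?_) stub_weightContinuity
  intro n w s X F G hF hG hs
  exact BHK2006_clusterConditionalPositiveAssociation_holds (Fin n) w s X F G hF hG hs

/-- **Log-scale lower tail, constant `16`.** For every finite weighted graph, relay set `A`,
hub `a₀ ∈ A` with star budget `P(a ↮ a₀) ≤ δ₀ (a ∈ A)`, observer `o` (NO hypothesis on `o`) and `t`:
`P(o ↮ a₀, 1 ≤ N' < t) ≤ 16 δ₀ ⌈log₂ t⌉`, `N' = |C(o) ∩ (A∖a₀)|`.  Proof: dyadic thinning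
(`stub_dyadicThinning`, `16·L·t` for the window `[K, K·2^L)`) fed with `nhlt_singleFingerHub`, at `K = 1`,
`L = ⌈log₂ t⌉`, relay set `A.erase a₀`, target `b := a₀`; `t ≤ 2^{⌈log₂ t⌉}` (`Nat.le_pow_clog`). -/
theorem nhlt_logScaleLowerTail
    (n : ℕ) (w : Sym2 (Fin n) → unitInterval) (A : Finset (Fin n)) (o a₀ : Fin n) (δ₀ : ℝ) (t : ℕ)
    (ha₀ : a₀ ∈ A) (hδ₀ : ∀ a ∈ A, (prodBernoulli w).real (openConn a a₀)ᶜ ≤ δ₀) :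
    (prodBernoulli w).real {ω : BondConfig (Fin n) | ω ∉ openConn o a₀ ∧
        1 ≤ ((A.erase a₀).filter fun a => ω ∈ openConn o a).card ∧
        ((A.erase a₀).filter fun a => ω ∈ openConn o a).card < t}
      ≤ 16 * δ₀ * (Nat.clog 2 t : ℝ) := by
  have hδ₀0 : 0 ≤ δ₀ := le_trans measureReal_nonneg (hδ₀ a₀ ha₀)
  have h := stub_dyadicThinning nhlt_singleFingerHub n w (A.erase a₀) o a₀ δ₀ 1 (Nat.clog 2 t) hδ₀0
    le_rfl (fun a ha => hδ₀ a (Finset.mem_of_mem_erase ha))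
  have hpow : t ≤ 1 * 2 ^ Nat.clog 2 t := by
    rw [one_mul]; exact Nat.le_pow_clog one_lt_two t
  calc (prodBernoulli w).real {ω : BondConfig (Fin n) | ω ∉ openConn o a₀ ∧
        1 ≤ ((A.erase a₀).filter fun a => ω ∈ openConn o a).card ∧
        ((A.erase a₀).filter fun a => ω ∈ openConn o a).card < t}
      ≤ (prodBernoulli w).real {ω : BondConfig (Fin n) | ω ∉ openConn o a₀ ∧
        1 ≤ ((A.erase a₀).filter fun a => ω ∈ openConn o a).card ∧
        ((A.erase a₀).filter fun a => ω ∈ openConn o a).card < 1 * 2 ^ Nat.clog 2 t} := by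
          refine measureReal_mono ?_
          rintro ω ⟨h1, h2, h3⟩
          exact ⟨h1, h2, lt_of_lt_of_le h3 hpow⟩
    _ ≤ 16 * (Nat.clog 2 t : ℝ) * δ₀ := h
    _ = 16 * δ₀ * (Nat.clog 2 t : ℝ) := by ring

/-- **Hub block bound (Markov).** On `{o ↔ a₀}` the relay points joined to `o` are exactly those joined
to the hub `a₀`, so `N = |A| − Y` with `Y = #{a ∈ A : a ↮ a₀}`; Markov's inequality for `Y` gives
`P(o ↔ a₀, N < t) ≤ (Σ_{a∈A} P(a ↮ a₀)) / (|A| − t)` for `t < |A|`. -/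
theorem nhlt_hubBlockMarkov
    (n : ℕ) (w : Sym2 (Fin n) → unitInterval) (A : Finset (Fin n)) (o a₀ : Fin n) (t : ℝ)
    (ht : t < A.card) :
    (prodBernoulli w).real {ω : BondConfig (Fin n) | ω ∈ openConn o a₀ ∧
        ((A.filter fun a => ω ∈ openConn o a).card : ℝ) < t}
      ≤ (∑ a ∈ A, (prodBernoulli w).real (openConn a a₀)ᶜ) / (A.card - t) := by
  set μ := prodBernoulli w with hμ
  -- the deficit `Y` = number of relay points cut from the hub, as a sum of indicators
  set Y : BondConfig (Fin n) → ℝ :=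
    fun ω => ∑ a ∈ A, ((openConn a a₀ : Set (BondConfig (Fin n)))ᶜ).indicator (fun _ => (1 : ℝ)) ω
    with hY
  have hmeas : ∀ a ∈ A, MeasurableSet ((openConn a a₀ : Set (BondConfig (Fin n)))ᶜ) :=
    fun a _ => (measurableSet_openConn_holds a a₀).compl
  have hint : ∀ a ∈ A, Integrable
      (((openConn a a₀ : Set (BondConfig (Fin n)))ᶜ).indicator (fun _ => (1 : ℝ))) μ :=
    fun a ha => (integrable_const (1 : ℝ)).indicator (hmeas a ha)
  have hY_int : Integrable Y μ := integrable_finsetSum A hint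
  have hY_nonneg : 0 ≤ᵐ[μ] Y := Filter.Eventually.of_forall fun ω =>
    Finset.sum_nonneg fun a _ => Set.indicator_nonneg (fun _ _ => zero_le_one) _
  have hY_integral : ∫ ω, Y ω ∂μ = ∑ a ∈ A, μ.real (openConn a a₀)ᶜ := by
    rw [integral_finsetSum A hint]
    refine Finset.sum_congr rfl fun a ha => ?_
    rw [integral_indicator_const (1 : ℝ) (hmeas a ha), smul_eq_mul, mul_one]
  -- on the event, `Y = |A| - N > |A| - t`
  have hsub : {ω : BondConfig (Fin n) | ω ∈ openConn o a₀ ∧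
      ((A.filter fun a => ω ∈ openConn o a).card : ℝ) < t} ⊆ {ω | (A.card : ℝ) - t ≤ Y ω} := by
    rintro ω ⟨hoa, hN⟩
    have hfilt : (A.filter fun a => ω ∈ openConn o a) = (A.filter fun a => ω ∈ openConn a a₀) := by
      refine Finset.filter_congr fun a _ => ?_
      simp only [openConn, Set.mem_setOf_eq] at hoa ⊢
      exact ⟨fun h => h.symm.trans hoa, fun h => hoa.trans h.symm⟩
    have hYω : Y ω = (A.card : ℝ) - ((A.filter fun a => ω ∈ openConn a a₀).card : ℝ) := by
      have hterm : ∀ a ∈ A,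
          ((openConn a a₀ : Set (BondConfig (Fin n)))ᶜ).indicator (fun _ => (1 : ℝ)) ω
            = 1 - (if ω ∈ openConn a a₀ then (1 : ℝ) else 0) := by
        intro a _
        by_cases h : ω ∈ openConn a a₀ <;> simp [h]
      simp only [hY]
      rw [Finset.sum_congr rfl hterm, Finset.sum_sub_distrib, Finset.sum_const, nsmul_eq_mul,
        mul_one, Finset.sum_boole]
    show (A.card : ℝ) - t ≤ Y ω
    rw [hYω]
    rw [hfilt] at hN
    linarith
  have hpos : 0 < (A.card : ℝ) - t := by linarith
  have hmarkov := mul_meas_ge_le_integral_of_nonneg hY_nonneg hY_int ((A.card : ℝ) - t)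
  rw [hY_integral] at hmarkov
  calc μ.real {ω : BondConfig (Fin n) | ω ∈ openConn o a₀ ∧
        ((A.filter fun a => ω ∈ openConn o a).card : ℝ) < t}
      ≤ μ.real {ω | (A.card : ℝ) - t ≤ Y ω} := measureReal_mono hsub
    _ ≤ (∑ a ∈ A, μ.real (openConn a a₀)ᶜ) / (A.card - t) := by
        rw [le_div_iff₀ hpos]
        linarith [hmarkov]

/-- Choice of `δ`: the error budget `(3 + 16L)δ + 2√δ + C₁(2δ)^κ₁` is continuous at `0` with value
`0`, so it is `< ε` for some `0 < δ ≤ min (ε'/2) δ₁` (any positive caps `ε'`, `δ₁`). -/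
theorem nhlt_exists_delta (ε ε' δ₁ L C₁ κ₁ : ℝ) (hε : 0 < ε) (hε' : 0 < ε') (hδ₁ : 0 < δ₁)
    (hκ₁ : 0 < κ₁) :
    ∃ δ : ℝ, 0 < δ ∧ δ ≤ ε' / 2 ∧ δ ≤ δ₁ ∧
      (3 + 16 * L) * δ + 2 * Real.sqrt δ + C₁ * (2 * δ) ^ κ₁ < ε := by
  set f : ℝ → ℝ := fun x => (3 + 16 * L) * x + 2 * Real.sqrt x + C₁ * (2 * x) ^ κ₁ with hf
  have h2 : Continuous fun x : ℝ => 2 * x := continuous_const.mul continuous_id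
  have hcont : Continuous f := by
    refine (((continuous_const.mul continuous_id).add
      (continuous_const.mul Real.continuous_sqrt)).add
      (continuous_const.mul ((Real.continuous_rpow_const hκ₁.le).comp h2)))
  have hf0 : f 0 < ε := by
    simp [hf, Real.zero_rpow hκ₁.ne', hε]
  have hev : ∀ᶠ x in 𝓝 (0 : ℝ), f x < ε :=
    hcont.continuousAt.eventually_lt continuousAt_const hf0
  have hev' : ∀ᶠ x in 𝓝 (0 : ℝ), x < min (ε' / 2) δ₁ := eventually_lt_nhds (by positivity)
  have hw : ∀ᶠ x in 𝓝[>] (0 : ℝ), (f x < ε ∧ x < min (ε' / 2) δ₁) ∧ 0 < x :=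
    ((hev.and hev').filter_mono nhdsWithin_le_nhds).and self_mem_nhdsWithin
  obtain ⟨δ, ⟨h1, h3⟩, h4⟩ := hw.exists
  exact ⟨δ, h4, (h3.le.trans (min_le_left _ _)), (h3.le.trans (min_le_right _ _)), h1⟩

/-- **The reduction of `NoHeavyLowerTail` to the many-finger large-pocket residual.**  If for every `ε > 0` there
are `δ > 0` and sizes `d₀, s₀` such that, on every finite weighted graph, for a pairwise `δ`-reliable
relay set `A`, a hub `a₀ ∈ A` and an observer `o ∉ A` with `P(o ↮ A) ≤ δ`, the event "`o ↮ a₀`, `o` is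
joined to at least `s₀` and at most `|A|/2` points of `A ∖ a₀`, and `o` has more than `d₀` pioneers"
has probability `≤ ε`, then `NoHeavyLowerTail` holds.  Composition: given `ε`, take `δᵣ, d₀, s₀` from the
hypothesis at `ε/2`, `C₁, κ₁` from `stub_fewFingersHub` at `d₀`, `s₁ = max s₀ 2`, `L = ⌈log₂ s₁⌉`,
and `δ ≤ min (ε/2) δᵣ` from `nhlt_exists_delta` with budget `ε/2`; `A = ∅` is trivial; if `o ∈ A` take
the hub `a₀ := o` (hub block, `≤ 2δ`); otherwise fix a hub `a₀ ∈ A`; `t = δ·EN/ε ≤ |A|/2`; the bad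
event `{1 ≤ N < t}` lies in `{o ↔ a₀, N < |A|/2}` (`≤ 2δ`) ∪ `{o ↮ a₀, 1 ≤ N' < s₁}` (`nhlt_logScaleLowerTail`,
`≤ 16δL`) ∪ `{o ↮ a₀, 1 ≤ N', |D| ≤ 1}` (`stub_oneFingerHub`, `≤ δ + 2√δ`) ∪ `{o ↮ a₀, 2 ≤ |D| ≤ d₀}`
(`stub_fewFingersHub`, `≤ C₁(2δ)^κ₁`) ∪ the residual event at level `δ ≤ δᵣ` (`≤ ε/2`). -/
theorem noHeavyLowerTail_of_manyFingersLargePocket'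
    (hRes : ∀ ε : ℝ, 0 < ε → ∃ (δ : ℝ) (d₀ s₀ : ℕ), 0 < δ ∧
          ∀ (n : ℕ) (w : Sym2 (Fin n) → unitInterval) (A : Finset (Fin n)) (o a₀ : Fin n),
            a₀ ∈ A → o ∉ A →
            (∀ a ∈ A, ∀ a' ∈ A, (prodBernoulli w).real (openConn a a')ᶜ ≤ δ) →
            (prodBernoulli w).real (⋃ a ∈ A, openConn o a)ᶜ ≤ δ →
            (prodBernoulli w).real {ω : BondConfig (Fin n) | ω ∉ openConn o a₀ ∧
                s₀ ≤ ((A.erase a₀).filter fun a => ω ∈ openConn o a).card ∧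
                2 * ((A.erase a₀).filter fun a => ω ∈ openConn o a).card ≤ A.card ∧
                d₀ < (A.filter fun a => ω ∈ openConnIn ((↑A : Set (Fin n))ᶜ ∪ {o, a}) o a).card}
              ≤ ε) :
    NoHeavyLowerTail := by
  intro ε hε
  -- the residual and the three auxiliary bounds
  obtain ⟨δᵣ, d₀, s₀, hδᵣ, hMany⟩ := hRes (ε / 2) (by positivity)
  obtain ⟨C₁, κ₁, hC₁, hκ₁, hFew⟩ := stub_fewFingersHub stub_spreadSwitch d₀
  have hOne := stub_oneFingerHub stub_spreadSwitch
  -- constants of the line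
  obtain ⟨s₁, hs₁2, hs₀s₁⟩ : ∃ s₁ : ℕ, 2 ≤ s₁ ∧ s₀ ≤ s₁ := ⟨max s₀ 2, le_max_right _ _, le_max_left _ _⟩
  set L : ℝ := (Nat.clog 2 s₁ : ℝ) with hL_def
  have hL0 : 0 ≤ L := Nat.cast_nonneg _
  obtain ⟨δ, hδ0, hδ1, hδr, hsum⟩ :=
    nhlt_exists_delta (ε / 2) ε δᵣ L C₁ κ₁ (by positivity) hε hδᵣ hκ₁
  refine ⟨δ, hδ0, fun n w A o hH1 hH2 => ?_⟩
  -- positivity of the error terms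
  have hsq0 : 0 ≤ Real.sqrt δ := Real.sqrt_nonneg δ
  have hp1 : 0 ≤ C₁ * (2 * δ) ^ κ₁ := mul_nonneg hC₁.le (Real.rpow_nonneg (by linarith) _)
  have hLδ : 0 ≤ 16 * δ * L := by positivity
  -- empty relay set: the bad event is empty
  rcases A.eq_empty_or_nonempty with hA | hAne
  · subst hA
    simp [hε]
  have hcard_pos : (0 : ℝ) < A.card := by exact_mod_cast Finset.card_pos.mpr hAne
  -- pairwise budget (H2) and observer budget (H1) are both ≤ δ
  have hpair : ∀ a ∈ A, ∀ a' ∈ A, (prodBernoulli w).real (openConn a a')ᶜ ≤ δ := by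
    intro a ha a' ha'
    have h := hH2 a ha a' ha'
    rw [probReal_compl_eq_one_sub (measurableSet_openConn_holds a a')]
    linarith
  have hδ₁ : (prodBernoulli w).real (⋃ a ∈ A, openConn o a)ᶜ ≤ δ := by
    rw [probReal_compl_eq_one_sub
      (Finset.measurableSet_biUnion A fun a _ => measurableSet_openConn_holds o a)]
    linarith
  -- the threshold t = δ·EN/ε is at most |A|/2
  set EN : ℝ := ∑ a ∈ A, (prodBernoulli w).real (openConn o a) with hEN_def
  have hEN0 : 0 ≤ EN := Finset.sum_nonneg fun a _ => measureReal_nonneg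
  have hEN1 : EN ≤ A.card := by
    calc EN ≤ ∑ a ∈ A, (1 : ℝ) := Finset.sum_le_sum fun a _ => measureReal_le_one
      _ = A.card := by simp
  have ht : δ * EN / ε ≤ (A.card : ℝ) / 2 := by
    have h1 : δ * EN ≤ ε / 2 * A.card := mul_le_mul hδ1 hEN1 hEN0 (by positivity)
    calc δ * EN / ε ≤ ε / 2 * A.card / ε := div_le_div_of_nonneg_right h1 hε.le
      _ = (A.card : ℝ) / 2 := by field_simp
  -- the hub block bound, for any hub
  have hHub : ∀ a₀ ∈ A, (prodBernoulli w).real {ω : BondConfig (Fin n) | ω ∈ openConn o a₀ ∧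
      ((A.filter fun a => ω ∈ openConn o a).card : ℝ) < (A.card : ℝ) / 2} ≤ 2 * δ := by
    intro a₀ ha₀
    have h := nhlt_hubBlockMarkov n w A o a₀ ((A.card : ℝ) / 2) (by linarith)
    have hsum : (∑ a ∈ A, (prodBernoulli w).real (openConn a a₀)ᶜ) ≤ A.card * δ := by
      calc (∑ a ∈ A, (prodBernoulli w).real (openConn a a₀)ᶜ) ≤ ∑ a ∈ A, δ :=
            Finset.sum_le_sum fun a ha => hpair a ha a₀ ha₀
        _ = A.card * δ := by simp
    calc (prodBernoulli w).real {ω : BondConfig (Fin n) | ω ∈ openConn o a₀ ∧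
          ((A.filter fun a => ω ∈ openConn o a).card : ℝ) < (A.card : ℝ) / 2}
        ≤ (∑ a ∈ A, (prodBernoulli w).real (openConn a a₀)ᶜ) / (A.card - A.card / 2) := h
      _ ≤ (A.card * δ) / (A.card - A.card / 2) := div_le_div_of_nonneg_right hsum (by linarith)
      _ = 2 * δ := by field_simp; ring
  by_cases ho : o ∈ A
  · -- `o` is itself a relay point: take the hub `a₀ := o`; the bad event is in the hub block
    have hsub : {ω : BondConfig (Fin n) | 1 ≤ (A.filter fun a => ω ∈ openConn o a).card ∧
        ((A.filter fun a => ω ∈ openConn o a).card : ℝ) < δ * EN / ε} ⊆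
        {ω : BondConfig (Fin n) | ω ∈ openConn o o ∧
          ((A.filter fun a => ω ∈ openConn o a).card : ℝ) < (A.card : ℝ) / 2} := by
      intro ω hω
      exact ⟨SimpleGraph.Reachable.refl _, hω.2.trans_le ht⟩
    calc (prodBernoulli w).real {ω : BondConfig (Fin n) |
            1 ≤ (A.filter fun a => ω ∈ openConn o a).card ∧
            ((A.filter fun a => ω ∈ openConn o a).card : ℝ) < δ * EN / ε}
        ≤ (prodBernoulli w).real {ω : BondConfig (Fin n) | ω ∈ openConn o o ∧
            ((A.filter fun a => ω ∈ openConn o a).card : ℝ) < (A.card : ℝ) / 2} :=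
          measureReal_mono hsub
      _ ≤ 2 * δ := hHub o ho
      _ < ε := by nlinarith [hsum, hsq0, hp1, hLδ, hL0, hδ0]
  -- `o ∉ A`: fix a hub a₀ ∈ A and split
  obtain ⟨a₀, ha₀⟩ := hAne
  have hδ₀ : ∀ a ∈ A, (prodBernoulli w).real (openConn a a₀)ᶜ ≤ δ := fun a ha => hpair a ha a₀ ha₀
  -- the residual's hypotheses hold at level δᵣ ≥ δ
  have hpairᵣ : ∀ a ∈ A, ∀ a' ∈ A, (prodBernoulli w).real (openConn a a')ᶜ ≤ δᵣ :=
    fun a ha a' ha' => (hpair a ha a' ha').trans hδr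
  have hδ₁ᵣ : (prodBernoulli w).real (⋃ a ∈ A, openConn o a)ᶜ ≤ δᵣ := hδ₁.trans hδr
  -- the five pieces of the bad event
  set E₁ : Set (BondConfig (Fin n)) := {ω | ω ∈ openConn o a₀ ∧
      ((A.filter fun a => ω ∈ openConn o a).card : ℝ) < (A.card : ℝ) / 2} with hE₁
  set E₂ : Set (BondConfig (Fin n)) := {ω | ω ∉ openConn o a₀ ∧
      1 ≤ ((A.erase a₀).filter fun a => ω ∈ openConn o a).card ∧
      ((A.erase a₀).filter fun a => ω ∈ openConn o a).card < s₁} with hE₂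
  set E₃ : Set (BondConfig (Fin n)) := {ω | ω ∉ openConn o a₀ ∧
      1 ≤ ((A.erase a₀).filter fun a => ω ∈ openConn o a).card ∧
      (A.filter fun a => ω ∈ openConnIn ((↑A : Set (Fin n))ᶜ ∪ {o, a}) o a).card ≤ 1} with hE₃
  set E₄ : Set (BondConfig (Fin n)) := {ω | ω ∉ openConn o a₀ ∧
      2 ≤ (A.filter fun a => ω ∈ openConnIn ((↑A : Set (Fin n))ᶜ ∪ {o, a}) o a).card ∧
      (A.filter fun a => ω ∈ openConnIn ((↑A : Set (Fin n))ᶜ ∪ {o, a}) o a).card ≤ d₀} with hE₄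
  set E₅ : Set (BondConfig (Fin n)) := {ω | ω ∉ openConn o a₀ ∧
      s₀ ≤ ((A.erase a₀).filter fun a => ω ∈ openConn o a).card ∧
      2 * ((A.erase a₀).filter fun a => ω ∈ openConn o a).card ≤ A.card ∧
      d₀ < (A.filter fun a => ω ∈ openConnIn ((↑A : Set (Fin n))ᶜ ∪ {o, a}) o a).card} with hE₅
  -- their bounds
  have hB₁ : (prodBernoulli w).real E₁ ≤ 2 * δ := hHub a₀ ha₀
  have hB₂ : (prodBernoulli w).real E₂ ≤ 16 * δ * L := nhlt_logScaleLowerTail n w A o a₀ δ s₁ ha₀ hδ₀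
  have hB₃ : (prodBernoulli w).real E₃ ≤ δ + 2 * Real.sqrt δ := hOne n w A o a₀ δ δ ha₀ ho hδ₀ hδ₁
  have hB₄ : (prodBernoulli w).real E₄ ≤ C₁ * (2 * δ) ^ κ₁ := by
    have h := hFew n w A o a₀ δ δ ha₀ ho hδ₀ hδ₁
    rwa [show δ + δ = 2 * δ by ring] at h
  have hB₅ : (prodBernoulli w).real E₅ ≤ ε / 2 := hMany n w A o a₀ ha₀ ho hpairᵣ hδ₁ᵣ
  -- the bad event is covered by the five pieces
  have hsub : {ω : BondConfig (Fin n) | 1 ≤ (A.filter fun a => ω ∈ openConn o a).card ∧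
      ((A.filter fun a => ω ∈ openConn o a).card : ℝ) < δ * EN / ε} ⊆
      E₁ ∪ (E₂ ∪ (E₃ ∪ (E₄ ∪ E₅))) := by
    intro ω hω
    obtain ⟨h1, h2⟩ := hω
    by_cases hoa : ω ∈ openConn o a₀
    · exact Or.inl ⟨hoa, h2.trans_le ht⟩
    · have hfilt : (A.filter fun a => ω ∈ openConn o a) =
          ((A.erase a₀).filter fun a => ω ∈ openConn o a) := by
        rw [Finset.filter_erase, Finset.erase_eq_self.mpr (by simp [hoa])]
      rw [hfilt] at h1 h2
      by_cases hsmall : ((A.erase a₀).filter fun a => ω ∈ openConn o a).card < s₁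
      · exact Or.inr (Or.inl ⟨hoa, h1, hsmall⟩)
      · have hlarge : s₀ ≤ ((A.erase a₀).filter fun a => ω ∈ openConn o a).card :=
          hs₀s₁.trans (not_lt.mp hsmall)
        have h3 : ((((A.erase a₀).filter fun a => ω ∈ openConn o a).card : ℕ) : ℝ) < A.card / 2 :=
          h2.trans_le ht
        have h4 : ((2 * ((A.erase a₀).filter fun a => ω ∈ openConn o a).card : ℕ) : ℝ) ≤ A.card := by
          push_cast; linarith
        have hhalf : 2 * ((A.erase a₀).filter fun a => ω ∈ openConn o a).card ≤ A.card := by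
          exact_mod_cast h4
        set D := (A.filter fun a => ω ∈ openConnIn ((↑A : Set (Fin n))ᶜ ∪ {o, a}) o a).card
          with hD
        by_cases hD1 : D ≤ 1
        · exact Or.inr (Or.inr (Or.inl ⟨hoa, h1, hD1⟩))
        · by_cases hDd : D ≤ d₀
          · exact Or.inr (Or.inr (Or.inr (Or.inl ⟨hoa, by omega, hDd⟩)))
          · exact Or.inr (Or.inr (Or.inr (Or.inr ⟨hoa, hlarge, hhalf, by omega⟩)))
  -- add up
  have hfin : (prodBernoulli w).real (E₁ ∪ (E₂ ∪ (E₃ ∪ (E₄ ∪ E₅)))) < ε := by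
    calc (prodBernoulli w).real (E₁ ∪ (E₂ ∪ (E₃ ∪ (E₄ ∪ E₅))))
        ≤ (prodBernoulli w).real E₁ + ((prodBernoulli w).real E₂ + ((prodBernoulli w).real E₃ +
            ((prodBernoulli w).real E₄ + (prodBernoulli w).real E₅))) := by
          refine (measureReal_union_le _ _).trans (add_le_add le_rfl ?_)
          refine (measureReal_union_le _ _).trans (add_le_add le_rfl ?_)
          refine (measureReal_union_le _ _).trans (add_le_add le_rfl ?_)
          exact measureReal_union_le _ _
      _ ≤ 2 * δ + (16 * δ * L + ((δ + 2 * Real.sqrt δ) +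
            (C₁ * (2 * δ) ^ κ₁ + ε / 2))) :=
          add_le_add hB₁ (add_le_add hB₂ (add_le_add hB₃ (add_le_add hB₄ hB₅)))
      _ = ((3 + 16 * L) * δ + 2 * Real.sqrt δ + C₁ * (2 * δ) ^ κ₁) + ε / 2 := by ring
      _ < ε / 2 + ε / 2 := by linarith
      _ = ε := by ring
  exact (measureReal_mono hsub).trans_lt hfin


/-- **The many-finger large-pocket residual implies `NoHeavyLowerTail`** (fully qualified signature) —
see `noHeavyLowerTail_of_manyFingersLargePocket'`. -/
theorem noHeavyLowerTail_of_manyFingersLargePocket :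
    (∀ ε : ℝ, 0 < ε → ∃ (δ : ℝ) (d₀ s₀ : ℕ), 0 < δ ∧ ∀ (n : ℕ) (w : Sym2 (Fin n) → unitInterval) (A
      : Finset (Fin n)) (o a₀ : Fin n), a₀ ∈ A → o ∉ A → (∀ a ∈ A, ∀ a' ∈ A,
      (Literature.Probability.LatticeModels.prodBernoulli w).real
      (Literature.Probability.Percolation.openConn a a')ᶜ ≤ δ) →
      (Literature.Probability.LatticeModels.prodBernoulli w).real (⋃ a ∈ A,
      Literature.Probability.Percolation.openConn o a)ᶜ ≤ δ →
      (Literature.Probability.LatticeModels.prodBernoulli w).real {ω :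
      Literature.Probability.Percolation.BondConfig (Fin n) | ω ∉
      Literature.Probability.Percolation.openConn o a₀ ∧ s₀ ≤ ((A.erase a₀).filter fun a => ω ∈
      Literature.Probability.Percolation.openConn o a).card ∧ 2 * ((A.erase a₀).filter fun a => ω ∈
      Literature.Probability.Percolation.openConn o a).card ≤ A.card ∧ d₀ < (A.filter fun a => ω ∈
      Literature.Probability.Percolation.openConnIn ((↑A : Set (Fin n))ᶜ ∪ {o, a}) o a).card} ≤ ε) →
      Summit.CriticalPhenomena.PercolationContinuityZ3.Theses.PercNearOneGluing.NoHeavyLowerTail :=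
  fun hRes => noHeavyLowerTail_of_manyFingersLargePocket' hRes

end Summit.CriticalPhenomena.PercolationContinuityZ3.Theorems

end
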